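import Literature.Topology.FourManifolds.SphereProductThomCollapse
import Literature.Topology.FourManifolds.SphereProductTube
import Literature.Topology.FourManifolds.BoundarySignature
import Literature.Topology.FourManifolds.IntersectionLatticeOrientationProofs
import Literature.Topology.FourManifolds.CollarTheorem
import HarnessLib

/-!
# Fundamental classes on the Thom space of the tube of the diagonal of `Sᵏ × Sᵏ`

Topic `Literature/Topology/FourManifolds` (fact seat of
`Literature.Topology.FourManifolds.HomotopySphere.exists_intersectionForm_equivalent_e8Form`,
Kosinski's `E₈` plumbing, *Differential Manifolds* (1993), VI.12). Sequel of
`SphereProductThomCollapse.lean` and `SphereProductTube.lean`. For `k ≥ 2`, `k + k = n + 1`,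
`|c| < 1`, `X = Sᵏ × Sᵏ`, `N_c = {⟪p, q⟫ ≥ c}` the compact tube of the diagonal (a compact `C^∞`
manifold with boundary, `SphereProd.Tube`) and `N̂_c = int N_c ∪ {∞}` its Thom space — which is,
by definition, the tree's closed model `ClosedModel n N_c = N_c ∪ cone(∂N_c)`
(`BoundarySignature.lean`):

* `SphereProd.openTube`, `SphereProd.openTubeHomeomorph` — the open tube `N_c° = {⟪p, q⟫ > c}` is
  the interior of `N_c`; `SphereProd.isPathConnected_openTube` (slide `q` to `p` along the great
  circle, `inner_chord_ge`);
* `SphereProd.tubeCollapse : C(X, N̂_c)` — the Thom collapse (`SphereProd.thomCollapse` with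
  `φ = openTubeHomeomorph`); `SphereProd.Tube.nullCobordism` — `N_c` as a null-cobordism of
  `∂N_c = {⟪p, q⟫ = c}` (nonempty, `Tube.nonempty_bd`), so that the closed-model theorems of
  `ClosedModelRelOrientation.lean` apply to `N̂_c`;
* `HomologicalOrientation.ofClassOnOpen` — a class of `H_d(Z; ℤ)` with generating local images on
  an open subset `O` orients `O` (Hatcher §3.3, the family `x ↦ α|ₓ`);
* `SphereProd.isGenerator_toLocal_tubeCollapse` — `c₊[X]` has generating local images off `∞`
  (`OnePoint.isIso_map_collapse_local`);
* `SphereProd.eq_or_eq_neg_map_tubeCollapse_fundamentalClass` — **fundamental classes on the Thom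
  space are unique up to sign**: every `β ∈ Hₙ₊₁(N̂_c; ℤ)` whose local images generate off `∞`
  is `± c₊[X]` (the two classes orient the connected open manifold `N̂_c ∖ ∞ ≅ N_c°` and
  orientations of a connected manifold agree up to sign, Hatcher p. 234; the difference is then
  killed by `NullCobordism.eq_zero_of_forall_toLocal_eq_zero_of_ne_infty`, Hatcher Lemma 3.27 on
  the closed model, using a collar of `∂N_c`);
* `SphereProd.abs_kroneckerPairing_thomClass_sq_eq_two` — hence **`|⟨ξ ⌣ ξ, β⟩| = 2`** for the
  Thom class `ξ` (`exists_thomClass`) and every such `β` (`k` even): the model computation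
  behind Kosinski's `[Σᵢ : Σᵢ] = 2`, VI.(12.4), for the core spheres of a plumbing of copies of
  the tangent disc bundle of `S²ᵐ` — any closed (homology) manifold containing a copy of `N_c°`
  collapses onto `N̂_c`, its fundamental class going to such a `β`.

Everything is proved; no named facts (D-0026).

## References

* A. Kosinski, *Differential Manifolds* (1993), VI.12, (12.4). [Kosinski1993]
* J. Milnor, J. Stasheff, *Characteristic classes* (1974), §11 (Thm. 11.1, Cor. 11.2, Lemma 11.5),
  §18 p. 205. [MilnorStasheff1974]
* A. Hatcher, *Algebraic Topology* (2002), §3.3: Thm. 3.26, Lemma 3.27, pp. 231–236.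
  [HatcherAT2002]
* M. Kervaire, J. Milnor, *Groups of homotopy spheres I*, Ann. of Math. 77 (1963), §7 footnote
  pp. 528–529 (the closed homology manifold `W ∪ cone(bW)`). [KervaireMilnorAnnals1963]
* J. Milnor, *Morse theory* (1963), Thm. 3.1. [Milnor1963]
-/

open scoped Manifold ContDiff Topology RealInnerProductSpace
open Set Function CategoryTheory CategoryTheory.Limits Module
open Literature.Geometry.Manifold

noncomputable section

universe u

namespace Literature.Topology.FourManifolds

open Literature.AlgebraicTopology.SingularHomology

/-- Local notation: `𝔼 n` is the model Euclidean space `EuclideanSpace ℝ (Fin n)`. -/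
local notation "𝔼 " n:arg => EuclideanSpace ℝ (Fin n)

/-- Local notation: `𝕊 n` is the unit sphere in `EuclideanSpace ℝ (Fin (n + 1))`. -/
local notation "𝕊 " n:arg => (Metric.sphere (0 : EuclideanSpace ℝ (Fin (n + 1))) 1)

namespace SphereProd

variable {k n : ℕ} {hkn : k + k = n + 1}

/-! ### The open tube and the Thom space of the compact tube -/

section OpenTube

variable {c : ℝ}

/-- The open tube `N_c° = {(p, q) | ⟪p, q⟫ > c}` of the diagonal, as a subset of `Sᵏ × Sᵏ`.
[cite: MilnorStasheff1974, §11 Thm. 11.1 (tubular neighbourhood of the diagonal)] -/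
def openTube (k : ℕ) (c : ℝ) : Set ((𝕊 k) × (𝕊 k)) :=
  {pq | c < ⟪(pq.1 : 𝔼 (k + 1)), (pq.2 : 𝔼 (k + 1))⟫}

/-- The open tube is open. [folklore] -/
theorem isOpen_openTube (k : ℕ) (c : ℝ) : IsOpen (openTube k c) := by
  have hc : Continuous fun pq : (𝕊 k) × (𝕊 k) => ⟪(pq.1 : 𝔼 (k + 1)), (pq.2 : 𝔼 (k + 1))⟫ := by
    fun_prop
  exact isOpen_lt continuous_const hc

/-- The diagonal lies in the open tube (`c < 1`). [folklore] -/
theorem diagonal_subset_openTube (hc : c < 1) : diagonal k ⊆ openTube k c := by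
  rintro ⟨p, q⟩ (hpq : p = q)
  subst hpq
  change c < ⟪(p : 𝔼 (k + 1)), (p : 𝔼 (k + 1))⟫
  rw [real_inner_self_eq_norm_sq, norm_eq_of_mem_sphere p, one_pow]
  exact hc

variable (hc : |c| < 1)

/-- A point of the compact tube is an interior point iff `⟪p, q⟫ > c`. [cite: Milnor1963, Thm. 3.1] -/
theorem Tube.isInteriorPoint_iff (y : Tube k n hkn hc) :
    (𝓡∂ (n + 1)).IsInteriorPoint y ↔
      c < ⟪((Tube.toProd hc y).1 : 𝔼 (k + 1)), ((Tube.toProd hc y).2 : 𝔼 (k + 1))⟫ := by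
  rw [RegularSublevel.isInteriorPoint_iff, sub_neg]
  rfl

/-- **The open tube is the interior of the compact tube**: the homeomorphism
`N_c° ≃ₜ int N_c` (both directions are the identity on pairs of points). [cite: Milnor1963, Thm. 3.1] -/
def openTubeHomeomorph : ↥(openTube k c) ≃ₜ ManifoldInterior n (Tube k n hkn hc) where
  toFun pq := ⟨Tube.ofProd hc pq.1 (le_of_lt pq.2), (Tube.isInteriorPoint_iff hc _).2 (by
    rw [Tube.toProd_ofProd]; exact pq.2)⟩
  invFun y := ⟨Tube.toProd hc y.1, (Tube.isInteriorPoint_iff hc y.1).1 y.2⟩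
  left_inv pq := Subtype.ext rfl
  right_inv y := Subtype.ext (Tube.toProd_injective hc rfl)
  continuous_toFun := by
    refine Continuous.subtype_mk ?_ _
    -- `ofProd = mk ∘ into ∘ val`
    refine Continuous.subtype_mk ?_ _
    exact contMDiff_into.continuous.comp continuous_subtype_val
  continuous_invFun := by
    refine Continuous.subtype_mk ?_ _
    exact contMDiff_out.continuous.comp (continuous_subtype_val.comp continuous_subtype_val)

/-- On pairs of points the homeomorphism is the identity. [folklore] -/
@[simp] theorem toProd_openTubeHomeomorph (pq : ↥(openTube k c)) :
    Tube.toProd hc ((openTubeHomeomorph (hkn := hkn) hc pq).1) = pq.1 := rfl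

/-- **The Thom space of the tube** `N̂_c = int N_c ∪ {∞}`: the one-point compactification of the
interior of the compact tube. This is, by definition, the tree's closed model
`ClosedModel n N_c = N_c ∪ cone(∂N_c)` (`BoundarySignature.lean`), written here in the reducible
form on which the one-point-compactification API computes. [cite: MilnorStasheff1974, §18 p. 205] -/
abbrev ThomSp (k n : ℕ) (hkn : k + k = n + 1) (hc : |c| < 1) : Type :=
  OnePoint (ManifoldInterior n (Tube k n hkn hc))

/-- The Thom space is the closed model of the compact tube (definitional). [folklore] -/
theorem thomSp_eq_closedModel : ThomSp k n hkn hc = ClosedModel n (Tube k n hkn hc) := rfl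

/-- The Thom collapse of `Sᵏ × Sᵏ` onto the Thom space **`N̂_c = N_c / ∂N_c`** of the tube (the
Thom space of the tangent bundle of `Sᵏ`). [cite: MilnorStasheff1974, §18 p. 205] -/
def tubeCollapse (hc : |c| < 1) : C((𝕊 k) × (𝕊 k), ThomSp k n hkn hc) :=
  thomCollapse (isOpen_openTube k c) (openTubeHomeomorph hc)

/-- On the open tube the collapse is the embedding of the interior. [folklore] -/
theorem tubeCollapse_coe (u : ↥(openTube k c)) :
    tubeCollapse (hkn := hkn) hc u = ((openTubeHomeomorph hc u : ManifoldInterior n (Tube k n hkn hc)) : ThomSp k n hkn hc) :=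
  OnePoint.collapse_apply_coe _ _ u

/-- Off the open tube the collapse is the point at infinity (the cone point). [folklore] -/
theorem tubeCollapse_of_not_mem {pq : (𝕊 k) × (𝕊 k)} (h : pq ∉ openTube k c) :
    tubeCollapse (hkn := hkn) hc pq = OnePoint.infty :=
  OnePoint.collapse_apply_of_not_mem _ _ h

end OpenTube

/-! ### Charts on `ℝⁿ⁺¹`, orientations in degree `n + 1`, the tube as a null-cobordism -/

section TubeNullCobordism

variable {c : ℝ}

/-- `Sᵏ × Sᵏ` charted on `ℝⁿ⁺¹` (`k + k = n + 1`): the product atlas followed by the linear change of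
model `tubeModelHomeo` (the same structure as `SphereProd.PM`, on the product type itself; a
`def` used locally for the tree's theorems on closed topological `(n+1)`-manifolds). [folklore] -/
@[reducible] def chartedSpace' (hkn : k + k = n + 1) : ChartedSpace (𝔼 (n + 1)) ((𝕊 k) × (𝕊 k)) where
  atlas := (fun e => e ≫ₕ (tubeModelHomeo k n hkn).toOpenPartialHomeomorph) ''
    atlas (ModelProd (𝔼 k) (𝔼 k)) ((𝕊 k) × (𝕊 k))
  chartAt x := chartAt (ModelProd (𝔼 k) (𝔼 k)) x ≫ₕ (tubeModelHomeo k n hkn).toOpenPartialHomeomorph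
  mem_chart_source x := by simp
  chart_mem_atlas x := mem_image_of_mem _ (chart_mem_atlas _ x)

/-- `Sᵏ × Sᵏ` is `ℤ`-orientable in degree `n + 1 = 2k` (`k ≥ 2`; simply connected).
[cite: HatcherAT2002, Prop. 3.25] -/
theorem isOrientableOver' (hkn : k + k = n + 1) (hk : 2 ≤ k) :
    IsOrientableOver ℤ ((𝕊 k) × (𝕊 k)) (n + 1) := by
  letI : ChartedSpace (𝔼 (n + 1)) ((𝕊 k) × (𝕊 k)) := chartedSpace' hkn
  haveI := simplyConnectedSpace hk
  exact isOrientableOver_of_simplyConnectedSpace ℤ ((𝕊 k) × (𝕊 k))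

variable (hc : |c| < 1)

/-- `PM` is second countable (it is `Sᵏ × Sᵏ`). [folklore] -/
instance instSecondCountableTopologyPM : SecondCountableTopology (PM k n hkn) :=
  inferInstanceAs (SecondCountableTopology ((𝕊 k) × (𝕊 k)))

/-- The boundary datum `∂N_c = {⟪p, q⟫ = c}` of the compact tube (the level, a closed smooth
`n`-manifold with its embedding onto the boundary). [cite: Milnor1963, Thm. 3.1] -/
def Tube.bd (hc : |c| < 1) : BoundaryData (𝓡∂ (n + 1)) (Tube k n hkn hc) (𝓡 n) :=
  RegularSublevel.boundaryData (isRegularLevel_dotFn (hkn := hkn) hc).const_sub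

/-- **The compact tube as a null-cobordism of its boundary** `∂N_c` (Kervaire–Milnor's `bM`):
`W = N_c`, `∂W = {⟪p, q⟫ = c}`. [cite: Milnor1963, Thm. 3.1] [cite: KervaireMilnorAnnals1963, §1] -/
@[reducible] def Tube.nullCobordism (hc : |c| < 1) : NullCobordism n (Tube.bd (hkn := hkn) hc).carrier where
  W := Tube k n hkn hc
  incl := (Tube.bd hc).incl
  isSmoothEmbedding_incl := (Tube.bd hc).isSmoothEmbedding
  range_incl := (Tube.bd hc).range_incl

/-- The bounding manifold of the null-cobordism is the tube (definitional). [folklore] -/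
@[simp] theorem Tube.nullCobordism_W : (Tube.nullCobordism (hkn := hkn) hc).W = Tube k n hkn hc := rfl

/-- The boundary of the compact tube is compact. [folklore] -/
theorem Tube.compactSpace_bd : CompactSpace (Tube.bd (hkn := hkn) hc).carrier :=
  BoundaryData.compactSpace_carrier _

include hc in
/-- A boundary point of the tube: `(e, c e + √(1 - c²) e')` for the last and the first basis
vectors `e`, `e'` (`k ≥ 1`). [folklore] -/
theorem Tube.exists_inner_eq (hk : 1 ≤ k) :
    ∃ pq : (𝕊 k) × (𝕊 k), ⟪(pq.1 : 𝔼 (k + 1)), (pq.2 : 𝔼 (k + 1))⟫ = c := by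
  -- `p = e_last`, `q = c e_last + s e_0` with `s = √(1 - c²)`
  set s : ℝ := Real.sqrt (1 - c ^ 2) with hs
  have hc2 : c ^ 2 < 1 := by
    have := abs_lt.1 hc
    nlinarith [sq_abs c]
  have hs2 : s ^ 2 = 1 - c ^ 2 := Real.sq_sqrt (by linarith)
  have hne : (Fin.last k) ≠ (0 : Fin (k + 1)) := by
    intro h
    have := congrArg Fin.val h
    simp at this
    omega
  let e : 𝔼 (k + 1) := EuclideanSpace.single (Fin.last k) 1
  let e' : 𝔼 (k + 1) := EuclideanSpace.single 0 1
  let q : 𝔼 (k + 1) := c • e + s • e'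
  have hee : ⟪e, e⟫ = 1 := by simp [e]
  have he'e' : ⟪e', e'⟫ = 1 := by simp [e']
  have hee' : ⟪e, e'⟫ = 0 := by
    rw [EuclideanSpace.inner_single_left]
    simp [e', hne]
  have he'e : ⟪e', e⟫ = 0 := by rw [real_inner_comm]; exact hee'
  have heq : ⟪e, q⟫ = c := by
    simp only [q, inner_add_right, inner_smul_right, hee, hee', mul_one, mul_zero, add_zero]
  have hqq : ⟪q, q⟫ = 1 := by
    simp only [q, inner_add_left, inner_add_right, inner_smul_left, inner_smul_right, hee, hee', he'e,
      he'e', RCLike.conj_to_real]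
    nlinarith [hs2]
  have he : ‖e‖ = 1 := by simp [e]
  have hq : ‖q‖ = 1 := by
    have h2 : ‖q‖ ^ 2 = 1 := by rw [← real_inner_self_eq_norm_sq]; exact hqq
    exact (pow_eq_one_iff_of_nonneg (norm_nonneg _) two_ne_zero).1 h2
  refine ⟨(⟨e, by simp [he]⟩, ⟨q, by simp [hq]⟩), ?_⟩
  exact heq

/-- The boundary of the tube is nonempty (`k ≥ 1`). [folklore] -/
theorem Tube.nonempty_bd (hk : 1 ≤ k) : Nonempty (Tube.bd (hkn := hkn) hc).carrier := by
  obtain ⟨pq, hpq⟩ := Tube.exists_inner_eq hc hk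
  let y : Tube k n hkn hc := Tube.ofProd hc pq hpq.ge
  have hy : y ∈ (𝓡∂ (n + 1)).boundary (Tube k n hkn hc) := (Tube.mem_boundary_iff hc y).2 hpq
  rw [← (Tube.bd hc).range_incl] at hy
  obtain ⟨b, -⟩ := hy
  exact ⟨b⟩

end TubeNullCobordism

/-! ### Fundamental classes on the Thom space are unique up to sign -/

section ThomFundamentalClass

variable {c : ℝ} (hc : |c| < 1)

/-! ### The open tube is path connected -/

/-- Along the chord from `q` to `p` the inner product with `p` stays at least `⟪p, q⟫` after
normalisation: `⟪p, (1-t) q + t p⟫ ≥ ⟪p, q⟫ ‖(1-t) q + t p‖` for unit `p`, `q` and `0 ≤ t ≤ 1`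
(the spherical distance to `p` decreases along the great circle). [folklore] -/
theorem inner_chord_ge {p q : 𝔼 (k + 1)} (hp : ‖p‖ = 1) (hq : ‖q‖ = 1) {t : ℝ} (ht0 : 0 ≤ t) (ht1 : t ≤ 1) :
    ⟪p, q⟫ * ‖(1 - t) • q + t • p‖ ≤ ⟪p, (1 - t) • q + t • p⟫ := by
  set a : ℝ := ⟪p, q⟫ with ha
  set γ : 𝔼 (k + 1) := (1 - t) • q + t • p with hγ
  have hpp : ⟪p, p⟫ = 1 := by rw [real_inner_self_eq_norm_sq, hp, one_pow]
  have hqq : ⟪q, q⟫ = 1 := by rw [real_inner_self_eq_norm_sq, hq, one_pow]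
  have hL : ⟪p, γ⟫ = (1 - t) * a + t := by
    rw [hγ, inner_add_right, inner_smul_right, inner_smul_right, hpp]; ring
  have hN2 : ‖γ‖ ^ 2 = (1 - t) ^ 2 + t ^ 2 + 2 * t * (1 - t) * a := by
    rw [← real_inner_self_eq_norm_sq, hγ]
    simp only [inner_add_left, inner_add_right, inner_smul_left, inner_smul_right, hpp, hqq,
      real_inner_comm p q, RCLike.conj_to_real]
    rw [← ha]; ring
  have hN1 : ‖γ‖ ≤ 1 := by
    calc ‖γ‖ ≤ ‖(1 - t) • q‖ + ‖t • p‖ := norm_add_le _ _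
      _ = 1 := by
        rw [norm_smul, norm_smul, hp, hq, Real.norm_eq_abs, Real.norm_eq_abs, abs_of_nonneg ht0,
          abs_of_nonneg (by linarith)]; ring
  have hN0 : 0 ≤ ‖γ‖ := norm_nonneg _
  have ha1 : a ≤ 1 := by
    have := real_inner_le_norm p q; rw [hp, hq] at this; linarith
  have ha1' : -1 ≤ a := by
    have := neg_le_of_abs_le (abs_real_inner_le_norm p q); rw [hp, hq] at this; linarith
  rw [hL]
  rcases le_or_gt 0 a with h0 | h0
  · -- `a ≥ 0`: `a ‖γ‖ ≤ a ≤ (1 - t) a + t`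
    nlinarith [mul_le_mul_of_nonneg_left hN1 h0]
  · rcases le_or_gt 0 ((1 - t) * a + t) with hL0 | hL0
    · nlinarith [mul_nonpos_iff.2 (Or.inr ⟨h0.le, hN0⟩)]
    · -- both sides negative: compare squares, `a² ‖γ‖² - L² = t (1 - a²) (-2a - t (1 - 2a)) ≥ 0`
      have hsq : ((1 - t) * a + t) ^ 2 ≤ (a * ‖γ‖) ^ 2 := by
        rw [mul_pow, hN2]
        have ht' : t * (1 - 2 * a) ≤ -2 * a := by nlinarith
        nlinarith [mul_nonneg ht0 (mul_nonneg (by nlinarith : (0 : ℝ) ≤ 1 - a ^ 2)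
          (by nlinarith : (0 : ℝ) ≤ -2 * a - t * (1 - 2 * a)))]
      have h1 : |(1 - t) * a + t| ≤ |a * ‖γ‖| := sq_le_sq.1 hsq
      rw [abs_of_neg hL0, abs_of_nonpos (mul_nonpos_iff.2 (Or.inr ⟨h0.le, hN0⟩))] at h1
      linarith

/-- The segment direction `(1-t) q + t p` never vanishes when `⟪p, q⟫ > -1` (any real `t`):
`‖(1-t) q + t p‖² = 1 - 2t(1-t)(1 - ⟪p, q⟫) ≥ (1 + ⟪p, q⟫)/2 > 0`. [folklore] -/
theorem norm_chord_pos {p q : 𝔼 (k + 1)} (hp : ‖p‖ = 1) (hq : ‖q‖ = 1) (hpq : -1 < ⟪p, q⟫) (t : ℝ) :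
    0 < ‖(1 - t) • q + t • p‖ := by
  have hpp : ⟪p, p⟫ = 1 := by rw [real_inner_self_eq_norm_sq, hp, one_pow]
  have hqq : ⟪q, q⟫ = 1 := by rw [real_inner_self_eq_norm_sq, hq, one_pow]
  have hN2 : ‖(1 - t) • q + t • p‖ ^ 2 = (1 - t) ^ 2 + t ^ 2 + 2 * t * (1 - t) * ⟪p, q⟫ := by
    rw [← real_inner_self_eq_norm_sq]
    simp only [inner_add_left, inner_add_right, inner_smul_left, inner_smul_right, hpp, hqq,
      real_inner_comm p q, RCLike.conj_to_real]
    ring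
  have ha1 : ⟪p, q⟫ ≤ 1 := by
    have := real_inner_le_norm p q; rw [hp, hq] at this; linarith
  have h4 : t * (1 - t) ≤ 1 / 4 := by nlinarith [sq_nonneg (1 - 2 * t)]
  have h2 : 0 < ‖(1 - t) • q + t • p‖ ^ 2 := by
    rw [hN2]
    nlinarith [mul_nonneg (sub_nonneg.2 ha1) (by linarith : (0 : ℝ) ≤ 1 - 4 * (t * (1 - t)))]
  exact lt_of_le_of_ne (norm_nonneg _) fun h => by rw [← h] at h2; simp at h2

/-- `Sᵏ` is path connected for `k ≥ 1`. [folklore] -/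
theorem pathConnectedSpace_sphere (hk : 1 ≤ k) : PathConnectedSpace (𝕊 k) := by
  have h1 : 1 < Module.rank ℝ (𝔼 (k + 1)) := by
    rw [← Module.finrank_eq_rank, finrank_euclideanSpace_fin]
    exact_mod_cast (by omega : 1 < k + 1)
  exact (isPathConnected_iff_pathConnectedSpace).1 (isPathConnected_sphere h1 (0 : 𝔼 (k + 1)) zero_le_one)

/-- **The open tube `{⟪p, q⟫ > c}` is path connected** (`k ≥ 1`, `-1 < c < 1`): slide `q` to `p`
along the great circle (the inner product with `p` only grows, `inner_chord_ge`), then move along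
the diagonal. [cite: MilnorStasheff1974, §11 Thm. 11.1 (the tube deformation retracts onto the diagonal)] -/
theorem isPathConnected_openTube (hk : 1 ≤ k) (hc1 : -1 < c) (hc2 : c < 1) :
    IsPathConnected (openTube k c) := by
  haveI := pathConnectedSpace_sphere hk
  -- every point is joined inside the open tube to the diagonal point `(p, p)`
  have hjoin : ∀ pq ∈ openTube k c, JoinedIn (openTube k c) pq (pq.1, pq.1) := by
    rintro ⟨p, q⟩ hpq
    have hp : ‖(p : 𝔼 (k + 1))‖ = 1 := norm_eq_of_mem_sphere p
    have hq : ‖(q : 𝔼 (k + 1))‖ = 1 := norm_eq_of_mem_sphere q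
    have ha : c < ⟪(p : 𝔼 (k + 1)), (q : 𝔼 (k + 1))⟫ := hpq
    set ch : unitInterval → 𝔼 (k + 1) := fun t =>
      (1 - (t : ℝ)) • (q : 𝔼 (k + 1)) + (t : ℝ) • (p : 𝔼 (k + 1)) with hch
    have hchc : Continuous ch := by fun_prop
    have hpos : ∀ t : unitInterval, 0 < ‖ch t‖ :=
      fun t => norm_chord_pos hp hq (by linarith) t
    have hN1 : ∀ t : unitInterval, ‖ch t‖ ≤ 1 := by
      intro t
      calc ‖ch t‖ ≤ ‖(1 - (t : ℝ)) • (q : 𝔼 (k + 1))‖ + ‖(t : ℝ) • (p : 𝔼 (k + 1))‖ := norm_add_le _ _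
        _ = 1 := by
          rw [norm_smul, norm_smul, hp, hq, Real.norm_eq_abs, Real.norm_eq_abs, abs_of_nonneg t.2.1,
            abs_of_nonneg (by linarith [t.2.2])]; ring
    let γ : unitInterval → (𝕊 k) × (𝕊 k) := fun t => (p, ⟨(‖ch t‖)⁻¹ • ch t, by
        simp [norm_smul, inv_mul_cancel₀ (hpos t).ne']⟩)
    have hγc : Continuous γ := by
      refine continuous_const.prodMk (Continuous.subtype_mk ?_ _)
      exact Continuous.smul (Continuous.inv₀ (continuous_norm.comp hchc) fun t => (hpos t).ne') hchc
    have hγ0 : γ 0 = (p, q) := by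
      refine Prod.ext rfl (Subtype.ext ?_)
      change (‖ch 0‖)⁻¹ • ch 0 = (q : 𝔼 (k + 1))
      have : ch 0 = (q : 𝔼 (k + 1)) := by simp [hch]
      rw [this, hq, inv_one, one_smul]
    have hγ1 : γ 1 = (p, p) := by
      refine Prod.ext rfl (Subtype.ext ?_)
      change (‖ch 1‖)⁻¹ • ch 1 = (p : 𝔼 (k + 1))
      have : ch 1 = (p : 𝔼 (k + 1)) := by simp [hch]
      rw [this, hp, inv_one, one_smul]
    have hmem : ∀ t, γ t ∈ openTube k c := by
      intro t
      change c < ⟪(p : 𝔼 (k + 1)), (‖ch t‖)⁻¹ • ch t⟫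
      rw [inner_smul_right]
      have hge : ⟪(p : 𝔼 (k + 1)), (q : 𝔼 (k + 1))⟫ * ‖ch t‖ ≤ ⟪(p : 𝔼 (k + 1)), ch t⟫ :=
        inner_chord_ge (k := k) hp hq t.2.1 t.2.2
      have hr := hpos t
      have h1 : c * ‖ch t‖ < ⟪(p : 𝔼 (k + 1)), ch t⟫ := by
        have : c * ‖ch t‖ < ⟪(p : 𝔼 (k + 1)), (q : 𝔼 (k + 1))⟫ * ‖ch t‖ :=
          mul_lt_mul_of_pos_right ha hr
        linarith
      calc c = (‖ch t‖)⁻¹ * (c * ‖ch t‖) := by field_simp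
        _ < (‖ch t‖)⁻¹ * ⟪(p : 𝔼 (k + 1)), ch t⟫ := mul_lt_mul_of_pos_left h1 (inv_pos.2 hr)
    exact ⟨⟨⟨γ, hγc⟩, hγ0, hγ1⟩, hmem⟩
  -- the diagonal is joined: `Sᵏ` is path connected
  have hdiag : ∀ p p' : 𝕊 k, JoinedIn (openTube k c) (p, p) (p', p') := by
    intro p p'
    obtain ⟨δ⟩ := PathConnectedSpace.joined (X := 𝕊 k) p p'
    exact ⟨δ.map (f := fun x : 𝕊 k => (x, x)) (by fun_prop), fun t => diagonal_subset_openTube hc2 rfl⟩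
  refine (isPathConnected_iff).2 ⟨⟨(southPole k, southPole k), diagonal_subset_openTube hc2 rfl⟩, ?_⟩
  intro x hx y hy
  exact ((hjoin x hx).trans (hdiag x.1 y.1)).trans (hjoin y hy).symm

/-! ### Orientations of an open subset from a class on the ambient space -/

/-- **An orientation of an open subset from an ambient class.** For `O ⊆ Z` open and a class
`θ ∈ H_d(Z; ℤ)` whose local images `θ|_y ∈ H_d(Z | y)` generate for all `y ∈ O`, the family
`y ↦ θ|_y` read in `H_d(O | y)` through excision is a `ℤ`-orientation of `O` (local consistency:
the classes `θ|_K ∈ H_d(Z | K)` for closed neighbourhoods `K ⊆ O`, excised likewise; Hatcher 2002,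
§3.3 p. 231 and Lemma 3.27, the construction of `x ↦ μ_x` from a class). [cite: HatcherAT2002, §3.3 p. 231 and Thm. 3.26] -/
def _root_.Literature.AlgebraicTopology.SingularHomology.HomologicalOrientation.ofClassOnOpen
    {Z : Type} [TopologicalSpace Z] [T1Space Z] [RegularSpace Z] {d : ℕ} {O : Set Z} (hO : IsOpen O)
    (θ : singularHomology ℤ ℤ Z d)
    (hθ : ∀ y : ↥O, ∃ e : localHomology ℤ ℤ Z (y : Z) d ≃ₗ[ℤ] ℤ,
      e (singularHomology.toLocal ℤ ℤ (y : Z) d θ) = 1) :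
    HomologicalOrientation ℤ (↥O) d where
  localClass y := (localHomology.openSubsetIso ℤ ℤ hO y.2 d).inv (singularHomology.toLocal ℤ ℤ (y : Z) d θ)
  isGenerator y := by
    obtain ⟨e, he⟩ := hθ y
    refine ⟨(localHomology.openSubsetIso ℤ ℤ hO y.2 d).toLinearEquiv.trans e, ?_⟩
    rw [LinearEquiv.trans_apply, Iso.toLinearEquiv_apply, Iso.inv_hom_id_apply, he]
  locallyConsistent y := by
    obtain ⟨K', hK'n, hK'c, hK'sub⟩ := exists_mem_nhds_isClosed_subset (hO.mem_nhds y.2)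
    have hclK' : closure K' ⊆ O := by rw [hK'c.closure_eq]; exact hK'sub
    refine ⟨Subtype.val ⁻¹' K', continuous_subtype_val.continuousAt.preimage_mem_nhds hK'n,
      (localHomologyOfSet.openSubsetIso ℤ ℤ hO hclK' d).inv (singularHomology.toLocalOfSet ℤ ℤ Z K' d θ),
      fun z hz ↦ ?_⟩
    rw [HomologicalOrientationOfSmooth.restrictToPoint_openSubsetIso_inv hO hclK' z hz d,
      singularHomology.restrictToPoint_toLocalOfSet]

/-- The defining property: excised back to `Z`, the local class at `y` is `θ|_y`. [folklore] -/
theorem _root_.Literature.AlgebraicTopology.SingularHomology.HomologicalOrientation.openSubsetIso_hom_ofClassOnOpen_localClass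
    {Z : Type} [TopologicalSpace Z] [T1Space Z] [RegularSpace Z] {d : ℕ} {O : Set Z} (hO : IsOpen O)
    (θ : singularHomology ℤ ℤ Z d)
    (hθ : ∀ y : ↥O, ∃ e : localHomology ℤ ℤ Z (y : Z) d ≃ₗ[ℤ] ℤ,
      e (singularHomology.toLocal ℤ ℤ (y : Z) d θ) = 1) (y : ↥O) :
    (localHomology.openSubsetIso ℤ ℤ hO y.2 d).hom
      ((HomologicalOrientation.ofClassOnOpen hO θ hθ).localClass y) =
      singularHomology.toLocal ℤ ℤ (y : Z) d θ :=
  Iso.inv_hom_id_apply _ _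

/-- Charts transported along a homeomorphism. [folklore] -/
@[reducible] def chartedSpaceOfHomeomorph {H : Type*} [TopologicalSpace H] {O S : Type*} [TopologicalSpace O]
    [TopologicalSpace S] [ChartedSpace H O] (e : S ≃ₜ O) : ChartedSpace H S where
  atlas := (fun ch => e.toOpenPartialHomeomorph ≫ₕ ch) '' atlas H O
  chartAt x := e.toOpenPartialHomeomorph ≫ₕ chartAt H (e x)
  mem_chart_source x := by simp
  chart_mem_atlas x := mem_image_of_mem _ (chart_mem_atlas H (e x))

/-! ### The finite part of the Thom space -/

/-- The finite part `N̂_c ∖ ∞` of the Thom space. [folklore] -/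
abbrev thomFinite (k n : ℕ) (hkn : k + k = n + 1) (hc : |c| < 1) : Set (ThomSp k n hkn hc) := {OnePoint.infty}ᶜ

/-- The finite part is open. [folklore] -/
theorem isOpen_thomFinite : IsOpen (thomFinite k n hkn hc) := isOpen_compl_singleton

/-- **The finite part of the Thom space is the open tube**: `N̂_c ∖ ∞ ≃ₜ int N_c ≃ₜ N_c°`. [folklore] -/
def thomFiniteHomeomorph (hc : |c| < 1) : ↥(thomFinite k n hkn hc) ≃ₜ ↥(openTube k c) :=
  ((Homeomorph.setCongr (OnePoint.compl_infty (X := ManifoldInterior n (Tube k n hkn hc)))).trans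
    (OnePoint.isOpenEmbedding_coe.toIsEmbedding.toHomeomorph).symm).trans (openTubeHomeomorph hc).symm

/-- The finite point of the Thom space over a point of the open tube, read back in the open tube,
is that point. [folklore] -/
theorem thomFiniteHomeomorph_apply_mk (u : ↥(openTube k c)) :
    thomFiniteHomeomorph (hkn := hkn) hc
      ⟨((openTubeHomeomorph hc u : ManifoldInterior n (Tube k n hkn hc)) : ThomSp k n hkn hc),
        fun h => OnePoint.coe_ne_infty _ h⟩ = u := by
  change (thomFiniteHomeomorph (hkn := hkn) hc) ((thomFiniteHomeomorph (hkn := hkn) hc).symm u) = u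
  exact (thomFiniteHomeomorph (hkn := hkn) hc).apply_symm_apply u

/-- The collapse of the point of `Sᵏ × Sᵏ` under a finite point of the Thom space is that point. [folklore] -/
theorem tubeCollapse_thomFiniteHomeomorph (x : ↥(thomFinite k n hkn hc)) :
    tubeCollapse hc ((thomFiniteHomeomorph hc x : ↥(openTube k c)) : (𝕊 k) × (𝕊 k)) = (x : ThomSp k n hkn hc) := by
  -- `x` is the image of `u = thomFiniteHomeomorph x`, i.e. `x = ⟨c u, _⟩`
  set u := thomFiniteHomeomorph (hkn := hkn) hc x with hu
  have hx : x = ⟨((openTubeHomeomorph hc u : ManifoldInterior n (Tube k n hkn hc)) : ThomSp k n hkn hc),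
      fun h => OnePoint.coe_ne_infty _ h⟩ := by
    apply (thomFiniteHomeomorph (hkn := hkn) hc).injective
    rw [thomFiniteHomeomorph_apply_mk]
  rw [tubeCollapse_coe]
  exact (congrArg Subtype.val hx).symm

/-- The finite part of the Thom space is connected (`k ≥ 1`): it is the open tube. [folklore] -/
theorem connectedSpace_thomFinite (hk : 1 ≤ k) : ConnectedSpace ↥(thomFinite k n hkn hc) := by
  have hP : IsPathConnected (openTube k c) := isPathConnected_openTube hk (abs_lt.1 hc).1 (abs_lt.1 hc).2
  haveI : PathConnectedSpace ↥(openTube k c) := (isPathConnected_iff_pathConnectedSpace).1 hP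
  have h2 : IsPathConnected (Set.univ : Set ↥(thomFinite k n hkn hc)) := by
    have := (isPathConnected_univ (X := ↥(openTube k c))).image
      (f := (thomFiniteHomeomorph (hkn := hkn) hc).symm) (thomFiniteHomeomorph (hkn := hkn) hc).symm.continuous
    rwa [Set.image_univ, (thomFiniteHomeomorph (hkn := hkn) hc).symm.surjective.range_eq] at this
  haveI := pathConnectedSpace_iff_univ.2 h2
  infer_instance

/-! ### Fundamental classes on the Thom space -/

set_option maxHeartbeats 800000 in
/-- **The collapsed fundamental class generates the local homology of the Thom space off `∞`**
(point of the open tube version). For an orientation `μ` of `Sᵏ × Sᵏ` in degree `n + 1 = 2k` and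
`u` in the open tube, the local image of `c₊[Sᵏ × Sᵏ]` at `c u` generates `Hₙ₊₁(N̂_c | c u) ≅ ℤ`:
the collapse induces isomorphisms of local homology at the points of the open tube
(`OnePoint.isIso_map_collapse_local`) and `[X]` restricts to the local orientations (Hatcher
Thm. 3.26). [cite: HatcherAT2002, Thm. 3.26 and §3.3 p. 231] -/
theorem isGenerator_toLocal_tubeCollapse (μ : HomologicalOrientation ℤ ((𝕊 k) × (𝕊 k)) (n + 1))
    (u : ↥(openTube k c)) :
    ∃ e : localHomology ℤ ℤ (ThomSp k n hkn hc)
        ((openTubeHomeomorph hc u : ManifoldInterior n (Tube k n hkn hc)) : ThomSp k n hkn hc) (n + 1) ≃ₗ[ℤ] ℤ,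
      e (singularHomology.toLocal ℤ ℤ
        ((openTubeHomeomorph hc u : ManifoldInterior n (Tube k n hkn hc)) : ThomSp k n hkn hc) (n + 1)
        (singularHomology.map ℤ ℤ (tubeCollapse hc) (n + 1) μ.fundamentalClass)) = 1 := by
  letI : ChartedSpace (𝔼 (n + 1)) ((𝕊 k) × (𝕊 k)) := chartedSpace' hkn
  have hmaps := OnePoint.mapsTo_collapse_compl_singleton (openTubeHomeomorph (hkn := hkn) hc).injective u
  haveI hI : IsIso (relativeSingularHomology.map ℤ ℤ (tubeCollapse (hkn := hkn) hc) hmaps (n + 1)) :=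
    OnePoint.isIso_map_collapse_local ℤ ℤ (isOpen_openTube k c) (openTubeHomeomorph (hkn := hkn) hc) u (n + 1)
  -- naturality of `toLocal` along the collapse
  have hnat : singularHomology.toLocal ℤ ℤ
      ((openTubeHomeomorph hc u : ManifoldInterior n (Tube k n hkn hc)) : ThomSp k n hkn hc) (n + 1)
      (singularHomology.map ℤ ℤ (tubeCollapse hc) (n + 1) μ.fundamentalClass) =
      relativeSingularHomology.map ℤ ℤ (tubeCollapse (hkn := hkn) hc) hmaps (n + 1)
        (singularHomology.toLocal ℤ ℤ (u : (𝕊 k) × (𝕊 k)) (n + 1) μ.fundamentalClass) := by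
    have h := relativeSingularHomology.ofAbsolute_comp_map (R := ℤ) (M := ℤ) (tubeCollapse (hkn := hkn) hc)
      hmaps (n + 1)
    have h2 := congrArg (fun f => f μ.fundamentalClass) h
    simp only [ModuleCat.comp_apply] at h2
    exact h2.symm
  -- `[X]` restricts to the local orientation at `u`
  have hfc : singularHomology.toLocal ℤ ℤ (u : (𝕊 k) × (𝕊 k)) (n + 1) μ.fundamentalClass = μ.localClass u :=
    HomologicalOrientation.isFundamentalClass_fundamentalClass_holds (R := ℤ) (X := (𝕊 k) × (𝕊 k)) (n + 1) μ u
  obtain ⟨eμ, heμ⟩ := μ.isGenerator (u : (𝕊 k) × (𝕊 k))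
  let eL := (asIso (relativeSingularHomology.map ℤ ℤ (tubeCollapse (hkn := hkn) hc) hmaps (n + 1))).toLinearEquiv
  have h3 : eL.symm (relativeSingularHomology.map ℤ ℤ (tubeCollapse (hkn := hkn) hc) hmaps (n + 1) (μ.localClass u)) =
      μ.localClass u :=
    eL.symm_apply_apply (μ.localClass u)
  refine ⟨eL.symm.trans eμ, ?_⟩
  rw [LinearEquiv.trans_apply, hnat, hfc, h3, heμ]

/-- The same at every finite point of the Thom space. [cite: HatcherAT2002, Thm. 3.26 and §3.3 p. 231] -/
theorem isGenerator_toLocal_tubeCollapse' (μ : HomologicalOrientation ℤ ((𝕊 k) × (𝕊 k)) (n + 1))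
    (x : ↥(thomFinite k n hkn hc)) :
    ∃ e : localHomology ℤ ℤ (ThomSp k n hkn hc) (x : ThomSp k n hkn hc) (n + 1) ≃ₗ[ℤ] ℤ,
      e (singularHomology.toLocal ℤ ℤ (x : ThomSp k n hkn hc) (n + 1)
        (singularHomology.map ℤ ℤ (tubeCollapse hc) (n + 1) μ.fundamentalClass)) = 1 := by
  have hcu := tubeCollapse_thomFiniteHomeomorph hc x
  rw [tubeCollapse_coe] at hcu
  rw [← hcu]
  exact isGenerator_toLocal_tubeCollapse hc μ _

set_option maxHeartbeats 800000 in
/-- **Fundamental classes on the Thom space are unique up to sign.** Let `k ≥ 2`,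
`n + 1 = 2k`, `|c| < 1`, `μ` an orientation of `Sᵏ × Sᵏ` and `β ∈ Hₙ₊₁(N̂_c; ℤ)` a class whose
local image generates `Hₙ₊₁(N̂_c | x)` at every `x ≠ ∞`. Then `β = ± c₊[Sᵏ × Sᵏ]`. Proof: both
`β` and `γ = c₊[X]` define `ℤ`-orientations of the connected open manifold `N̂_c ∖ ∞ ≅ N_c°`
(`HomologicalOrientation.ofClassOnOpen`), which agree up to a global sign (Hatcher p. 234,
`eq_or_eq_neg_of_connected_holds`); so `β ∓ γ` has vanishing local images off `∞`, hence is zero by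
uniqueness off the cone point of the closed model of the compact tube
(`NullCobordism.eq_zero_of_forall_toLocal_eq_zero_of_ne_infty`, using a collar of `∂N_c`).
[cite: HatcherAT2002, Lemma 3.27 and §3.3 p. 234] [cite: KervaireMilnorAnnals1963, §7, footnote pp. 528–529] -/
theorem eq_or_eq_neg_map_tubeCollapse_fundamentalClass (hk : 2 ≤ k)
    (μ : HomologicalOrientation ℤ ((𝕊 k) × (𝕊 k)) (n + 1))
    (β : singularHomology ℤ ℤ (ThomSp k n hkn hc) (n + 1))
    (hβ : ∀ x : ↥(thomFinite k n hkn hc),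
      ∃ e : localHomology ℤ ℤ (ThomSp k n hkn hc) (x : ThomSp k n hkn hc) (n + 1) ≃ₗ[ℤ] ℤ,
        e (singularHomology.toLocal ℤ ℤ (x : ThomSp k n hkn hc) (n + 1) β) = 1) :
    β = singularHomology.map ℤ ℤ (tubeCollapse hc) (n + 1) μ.fundamentalClass ∨
      β = -singularHomology.map ℤ ℤ (tubeCollapse hc) (n + 1) μ.fundamentalClass := by
  have hk1 : 1 ≤ k := by omega
  obtain ⟨n', rfl⟩ : ∃ n', n = n' + 1 := ⟨n - 1, by omega⟩
  -- a collar of `∂N_c` (for the uniqueness off the cone point)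
  haveI : Nonempty (Tube.bd (hkn := hkn) hc).carrier := Tube.nonempty_bd hc hk1
  haveI : CompactSpace (Tube.bd (hkn := hkn) hc).carrier := Tube.compactSpace_bd hc
  obtain ⟨κ⟩ := BoundaryData.nonempty_collar_of_compactSpace n' (Tube.nullCobordism (hkn := hkn) hc).W
    (Tube.nullCobordism (hkn := hkn) hc).boundaryData
  set γ : singularHomology ℤ ℤ (ThomSp k (n' + 1) hkn hc) (n' + 1 + 1) :=
    singularHomology.map ℤ ℤ (tubeCollapse hc) (n' + 1 + 1) μ.fundamentalClass with hγ
  -- the two orientations of the finite part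
  have hO : IsOpen (thomFinite k (n' + 1) hkn hc) := isOpen_thomFinite hc
  let νβ : HomologicalOrientation ℤ ↥(thomFinite k (n' + 1) hkn hc) (n' + 1 + 1) :=
    HomologicalOrientation.ofClassOnOpen hO β hβ
  let νγ : HomologicalOrientation ℤ ↥(thomFinite k (n' + 1) hkn hc) (n' + 1 + 1) :=
    HomologicalOrientation.ofClassOnOpen hO γ (isGenerator_toLocal_tubeCollapse' hc μ)
  -- local classes read in the Thom space
  have hloc : ∀ (θ : singularHomology ℤ ℤ (ThomSp k (n' + 1) hkn hc) (n' + 1 + 1)) (hθ) (x : ↥(thomFinite k (n' + 1) hkn hc)),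
      (localHomology.openSubsetIso ℤ ℤ hO x.2 (n' + 1 + 1)).hom
        ((HomologicalOrientation.ofClassOnOpen hO θ hθ).localClass x) =
      singularHomology.toLocal ℤ ℤ (x : ThomSp k (n' + 1) hkn hc) (n' + 1 + 1) θ :=
    fun θ hθ x => HomologicalOrientation.openSubsetIso_hom_ofClassOnOpen_localClass hO θ hθ x
  -- if the local classes of `β` and `γ` (resp. `-γ`) agree off `∞`, then `β = γ` (resp. `-γ`):
  -- uniqueness off the cone point of the closed model of the compact tube
  have key₁ : (∀ x : ↥(thomFinite k (n' + 1) hkn hc), νβ.localClass x = νγ.localClass x) → β = γ := by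
    intro hs
    rw [← sub_eq_zero]
    refine NullCobordism.eq_zero_of_forall_toLocal_eq_zero_of_ne_infty (Tube.nullCobordism hc) κ ℤ ℤ
      (β - γ) fun x hx => ?_
    have h1 := congrArg (localHomology.openSubsetIso ℤ ℤ hO (show x ∈ thomFinite k (n' + 1) hkn hc from hx)
      (n' + 1 + 1)).hom (hs ⟨x, hx⟩)
    rw [hloc β hβ ⟨x, hx⟩, hloc γ _ ⟨x, hx⟩] at h1
    exact (show singularHomology.toLocal ℤ ℤ (X := ThomSp k (n' + 1) hkn hc) x (n' + 1 + 1) (β - γ) = 0 by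
      rw [map_sub, sub_eq_zero]; exact h1)
  have key₂ : (∀ x : ↥(thomFinite k (n' + 1) hkn hc), νβ.localClass x = -νγ.localClass x) → β = -γ := by
    intro hs
    rw [← sub_eq_zero, sub_neg_eq_add]
    refine NullCobordism.eq_zero_of_forall_toLocal_eq_zero_of_ne_infty (Tube.nullCobordism hc) κ ℤ ℤ
      (β + γ) fun x hx => ?_
    have h1 := congrArg (localHomology.openSubsetIso ℤ ℤ hO (show x ∈ thomFinite k (n' + 1) hkn hc from hx)
      (n' + 1 + 1)).hom (hs ⟨x, hx⟩)
    rw [hloc β hβ ⟨x, hx⟩, map_neg, hloc γ _ ⟨x, hx⟩] at h1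
    exact (show singularHomology.toLocal ℤ ℤ (X := ThomSp k (n' + 1) hkn hc) x (n' + 1 + 1) (β + γ) = 0 by
      rw [map_add, h1, neg_add_cancel])
  -- the finite part is a connected topological manifold, so `νβ = ±νγ`
  letI : ChartedSpace (𝔼 (n' + 1 + 1)) ((𝕊 k) × (𝕊 k)) := chartedSpace' hkn
  letI : ChartedSpace (𝔼 (n' + 1 + 1)) ↥(openTube k c) :=
    inferInstanceAs (ChartedSpace (𝔼 (n' + 1 + 1))
      (⟨openTube k c, isOpen_openTube k c⟩ : TopologicalSpace.Opens ((𝕊 k) × (𝕊 k))))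
  letI : ChartedSpace (𝔼 (n' + 1 + 1)) ↥(thomFinite k (n' + 1) hkn hc) :=
    chartedSpaceOfHomeomorph (thomFiniteHomeomorph (hkn := hkn) hc)
  haveI : ConnectedSpace ↥(thomFinite k (n' + 1) hkn hc) := connectedSpace_thomFinite hc hk1
  rcases HomologicalOrientation.eq_or_eq_neg_of_connected_holds (↥(thomFinite k (n' + 1) hkn hc)) νβ νγ with h | h
  · exact Or.inl (key₁ fun x => by rw [h])
  · exact Or.inr (key₂ fun x => by rw [h, HomologicalOrientation.neg_localClass])

/-- **The square of the Thom class evaluates to `±2` on every fundamental class of the Thom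
space.** With `ξ` the Thom class of the tube (`exists_thomClass` for the open tube and
`φ = openTubeHomeomorph`) and `β ∈ Hₙ₊₁(N̂_c; ℤ)` any class with generating local images off `∞`:
`|⟨ξ ⌣ ξ, β⟩| = 2` (`k ≥ 2` even). This is the model computation behind Kosinski's
`[Σᵢ : Σᵢ] = 2` (VI.(12.4)) for the core spheres of a plumbing of copies of the tangent disc
bundle of `S²ᵐ`. [cite: Kosinski1993, VI.(12.4)] [cite: MilnorStasheff1974, §11 Cor. 11.2] -/
theorem abs_kroneckerPairing_thomClass_sq_eq_two (hk : 2 ≤ k) (hke : Even k)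
    (β : singularHomology ℤ ℤ (ThomSp k n hkn hc) (n + 1))
    (hβ : ∀ x : ↥(thomFinite k n hkn hc),
      ∃ e : localHomology ℤ ℤ (ThomSp k n hkn hc) (x : ThomSp k n hkn hc) (n + 1) ≃ₗ[ℤ] ℤ,
        e (singularHomology.toLocal ℤ ℤ (x : ThomSp k n hkn hc) (n + 1) β) = 1)
    {ξ : ↥(singularCohomology ℤ ℤ (ThomSp k n hkn hc) k)}
    (hξA : singularCohomology.map ℤ ℤ (thomIncl (openTubeHomeomorph hc)) k ξ =
      singularCohomology.map ℤ ℤ (subsetIncl (openTube k c)) k (g hk 0 + g hk 1))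
    (hξB : singularCohomology.map ℤ ℤ (subsetIncl (thomDiag (openTubeHomeomorph hc))ᶜ) k ξ = 0) :
    |kroneckerPairing ℤ ℤ (ThomSp k n hkn hc) (n + 1) (cupProduct hkn ξ ξ) β| = 2 := by
  obtain ⟨μ⟩ := isOrientableOver' hkn hk
  have hΔ : diagonal k ⊆ openTube k c := diagonal_subset_openTube (abs_lt.1 hc).2
  have h2 := abs_kroneckerPairing_thomClass_sq (isOpen_openTube k c) (openTubeHomeomorph hc) hk hke hΔ hkn μ hξA hξB
  rcases eq_or_eq_neg_map_tubeCollapse_fundamentalClass hc hk μ β hβ with h | h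
  · rw [h]; exact h2
  · rw [h, map_neg, abs_neg]; exact h2

end ThomFundamentalClass


end SphereProd

end Literature.Topology.FourManifolds

end
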